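import Literature.NumberTheory.EllipticCurves.SupersingularDensitySerreProofs
import Literature.NumberTheory.LFunctions.ChebotarevNaturalUpperBoundProofs
import HarnessLib

/-!
# Serre 1972, §4.2 c) over `ℚ`: the primes inert in a quadratic field do not have density `0`

Topic `NumberTheory/EllipticCurves` (density language of `SupersingularDensity`:
`WeierstrassCurve.HasPrimeDensity`, natural density of a set of rational primes).  Theorems only
(nothing is defined, no named fact).  The last step of c) ("Élimination du cas ii) pour presque
tout `l`") in the proof of Serre's open image theorem (J.-P. Serre, Invent. Math. 15 (1972),
§4.2, Théorème 2 — the tree's named fact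
`Literature.NumberTheory.EllipticCurves.serre_open_image`) over `K = ℚ` reads:

> Soit `Σ₁` l'ensemble des `v ∈ Σ` qui sont inertes dans `K'` … D'après le théorème de densité
> de Čebotarev, la densité de `Σ₁` est égale à `1/2`.  Mais d'autre part, comme `E` n'a pas de
> multiplication complexe, on sait que l'ensemble des places `v ∈ Σ` en lesquelles `Ẽ_v` est de
> hauteur 2 est de densité 0.  Ceci contredit le lemme 3.

Here `K'` is the quadratic field `ℚ̄^U` of an open subgroup `U ≤ Γ_ℚ` of index `2`, "inert" is
"an arithmetic Frobenius at a prime above `p` lies outside `U`", and the conclusion of Lemme 3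
(`SerreOpenImageLemmeTroisProofs`) together with the density-`0` statement (the named fact
`serre_supersingular_density_zero`) puts these primes, off a finite set, inside a set `T` of
natural density `0`.  The present file derives the contradiction
(`WeierstrassCurve.false_of_frobenius_not_mem_subset_density_zero`), with Čebotarev's theorem
replaced by the **unconditional natural upper bound** of the tree
(`Chebotarev.eventually_card_primesLE_filter_frobPrimes_le`, from Landau's prime ideal theorem):
the primes that split in `K'` (Frobenius in `U`) have upper natural density `≤ 1/2`, so the inert
ones cannot be covered by a density-`0` set and finitely many exceptions.

## References

* [Serre1972] J.-P. Serre, Invent. Math. 15 (1972) 259–331, §4.2 c).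
* [Serre1981] J.-P. Serre, Publ. Math. IHÉS 54 (1981), §2.1 (natural densities, Thm. 1 (9)).
-/

noncomputable section

open scoped Classical NumberField
open Filter Topology IsDedekindDomain Field

namespace WeierstrassCurve

open Literature.NumberTheory.LFunctions Literature.NumberTheory.LFunctions.Chebotarev
  Rat.HeightOneSpectrum

/-- **The inert primes of a quadratic field are not of density `0`** (§4.2 c), the density
contradiction, over `ℚ`).  Let `U ≤ Γ_ℚ` be open of index `2`, unramified outside a finite set
`S` of primes (`U` contains the inertia groups above every prime `p ∉ S`), and let `T` be a set
of primes of natural density `0`.  If every prime `p ∉ S` having an arithmetic Frobenius outside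
`U` at some prime of `\bar ℤ` above `p` ("`v` inerte dans `K'`") lies in `T`, we reach a
contradiction: the primes with all Frobenii in `U` have upper natural density `≤ 1/2`
(`Chebotarev.eventually_card_primesLE_filter_frobPrimes_le` for `Γ_ℚ → Γ_ℚ/U`, `H = 1`,
`C = {1}`, `k = 2`), and together with `S` and `T` they would exhaust the primes.
[cite: Serre1972, §4.2 c)] -/
theorem false_of_frobenius_not_mem_subset_density_zero (U : Subgroup (absoluteGaloisGroup ℚ))
    (hUopen : IsOpen (U : Set (absoluteGaloisGroup ℚ))) (hUind : U.index = 2)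
    (S : Set ℕ) (hS : S.Finite)
    (hUI : ∀ p : ℕ, p.Prime → p ∉ S → ∀ v : HeightOneSpectrum (𝓞 ℚ), (primesEquiv v : ℕ) = p →
      ∀ 𝔓 ∈ v.primesAbove, 𝔓.inertia (absoluteGaloisGroup ℚ) ≤ U)
    {T : Set ℕ} (hT : HasPrimeDensity T 0)
    (h : ∀ p : ℕ, p.Prime → p ∉ S → ∀ v : HeightOneSpectrum (𝓞 ℚ), (primesEquiv v : ℕ) = p →
      ∀ 𝔓 ∈ v.primesAbove, ∀ σ : absoluteGaloisGroup ℚ, IsArithFrobAt (𝓞 ℚ) σ 𝔓 → σ ∉ U →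
        p ∈ T) :
    False := by
  -- the quotient `φ : Γ_ℚ → Γ_ℚ / U`, a group of order `2`
  haveI hUn : U.Normal := Subgroup.normal_of_index_eq_two hUind
  haveI : U.FiniteIndex := ⟨by rw [hUind]; exact two_ne_zero⟩
  haveI : Finite (absoluteGaloisGroup ℚ ⧸ U) := Subgroup.finite_quotient_of_finiteIndex
  set φ : absoluteGaloisGroup ℚ →* absoluteGaloisGroup ℚ ⧸ U := QuotientGroup.mk' U with hφ
  have hker : IsOpen ((φ.ker : Subgroup (absoluteGaloisGroup ℚ)) :
      Set (absoluteGaloisGroup ℚ)) := by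
    rw [hφ, QuotientGroup.ker_mk']
    exact hUopen
  have hsurj : Function.Surjective φ := QuotientGroup.mk'_surjective U
  have hcardG : Nat.card (absoluteGaloisGroup ℚ ⧸ U) = 2 := by
    rw [← Subgroup.index_eq_card, hUind]
  -- `C = {1}` has `2` fixed points on `G / 1`
  have hCk : ∀ g ∈ ({1} : Set (absoluteGaloisGroup ℚ ⧸ U)),
      2 * Nat.card (⊥ : Subgroup (absoluteGaloisGroup ℚ ⧸ U)) ≤
        Nat.card {y : absoluteGaloisGroup ℚ ⧸ U // y⁻¹ * g * y ∈ (⊥ : Subgroup _)} := by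
    intro g hg
    rw [Set.mem_singleton_iff] at hg
    subst hg
    rw [Subgroup.card_bot, mul_one, ← hcardG]
    refine le_of_eq (Nat.card_congr (Equiv.subtypeUnivEquiv fun y ↦ ?_)).symm
    rw [mul_one, inv_mul_cancel]
    exact Subgroup.one_mem _
  have hbound := eventually_card_primesLE_filter_frobPrimes_le φ hker hsurj ⊥ two_pos
    ({1} : Set (absoluteGaloisGroup ℚ ⧸ U)) hCk (show (0 : ℝ) < 1 / 8 by norm_num)
  -- every prime outside `S` is in `frobPrimes φ {1}` or in `T`
  have hcover : ∀ p : ℕ, p.Prime → p ∉ S → p ∉ frobPrimes φ ({1} : Set _) → p ∈ T := by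
    intro p hp hpS hpF
    obtain ⟨v, hv⟩ : ∃ v : HeightOneSpectrum (𝓞 ℚ), (primesEquiv v : ℕ) = p :=
      ⟨primesEquiv.symm ⟨p, hp⟩, by rw [Equiv.apply_symm_apply]⟩
    by_contra hpT
    apply hpF
    refine ⟨v, hv, fun 𝔓 h𝔓 σ hσ ↦ ?_, fun 𝔓 h𝔓 σ hσ ↦ ?_⟩
    · rw [hφ, QuotientGroup.mk'_apply, QuotientGroup.eq_one_iff]
      exact hUI p hp hpS v hv 𝔓 h𝔓 hσ
    · rw [Set.mem_singleton_iff, hφ, QuotientGroup.mk'_apply, QuotientGroup.eq_one_iff]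
      by_contra hσU
      exact hpT (h p hp hpS v hv 𝔓 h𝔓 σ hσ hσU)
  -- counting: `π(x) ≤ #S + #frob(x) + #T(x)`
  have hcount : ∀ x : ℕ, (Nat.primeCounting x : ℝ) ≤ hS.toFinset.card +
      ((Nat.primesLE x).filter (· ∈ frobPrimes φ ({1} : Set _))).card +
      ((Nat.primesLE x).filter (· ∈ T)).card := by
    intro x
    set A : Finset ℕ := hS.toFinset with hA
    set B : Finset ℕ := (Nat.primesLE x).filter
      (· ∈ frobPrimes φ ({1} : Set (absoluteGaloisGroup ℚ ⧸ U))) with hB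
    set D : Finset ℕ := (Nat.primesLE x).filter (· ∈ T) with hD
    have h1 : Nat.primesLE x ⊆ A ∪ B ∪ D := by
      intro p hp
      have hp' : p.Prime := (Nat.mem_primesLE.mp hp).2
      by_cases hpS : p ∈ S
      · exact Finset.mem_union_left _ (Finset.mem_union_left _ (hS.mem_toFinset.mpr hpS))
      · by_cases hpF : p ∈ frobPrimes φ ({1} : Set _)
        · exact Finset.mem_union_left _ (Finset.mem_union_right _
            (Finset.mem_filter.mpr ⟨hp, hpF⟩))
        · exact Finset.mem_union_right _ (Finset.mem_filter.mpr ⟨hp, hcover p hp' hpS hpF⟩)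
    have h2 := Finset.card_le_card h1
    have h3 : (A ∪ B ∪ D).card ≤ A.card + B.card + D.card :=
      (Finset.card_union_le (A ∪ B) D).trans (Nat.add_le_add_right (Finset.card_union_le A B) _)
    rw [← Nat.primesLE_card_eq_primeCounting]
    exact_mod_cast h2.trans h3
  -- densities: `#frob(x) ≤ (1/2 + 1/8) π(x)` and `#T(x) ≤ (1/4) π(x)` eventually
  have hTev : ∀ᶠ x : ℕ in atTop, (((Nat.primesLE x).filter (· ∈ T)).card : ℝ) ≤
      1 / 4 * Nat.primeCounting x := by
    have hT' : ∀ᶠ x : ℕ in atTop, primeCountingRatio T x < 1 / 4 :=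
      hT (Iio_mem_nhds (by norm_num))
    filter_upwards [hT'] with x hx
    rw [primeCountingRatio_eq] at hx
    rcases Nat.eq_zero_or_pos (Nat.primeCounting x) with h0 | hpos
    · have : ((Nat.primesLE x).filter (· ∈ T)).card = 0 := by
        apply Nat.eq_zero_of_le_zero
        rw [← h0, ← Nat.primesLE_card_eq_primeCounting]
        exact Finset.card_le_card (Finset.filter_subset _ _)
      rw [this, h0]
      simp
    · have hpos' : (0 : ℝ) < Nat.primeCounting x := by exact_mod_cast hpos
      exact ((div_lt_iff₀ hpos').mp hx).le
  have hπ : Tendsto (fun x : ℕ ↦ (Nat.primeCounting x : ℝ)) atTop atTop :=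
    tendsto_natCast_atTop_atTop.comp Nat.tendsto_primeCounting
  have hbig : ∀ᶠ x : ℕ in atTop, (8 * (hS.toFinset.card + 1) : ℝ) ≤ Nat.primeCounting x :=
    hπ.eventually_ge_atTop _
  obtain ⟨x, hx1, hx2, hx3⟩ := (hbound.and (hTev.and hbig)).exists
  have hc := hcount x
  nlinarith [hc, hx1, hx2, hx3]

end WeierstrassCurve
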